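import Summits.HodgeConjecture.CorCM.IrreducibleOddWeightsCommutantDominationFamilies
import HarnessLib

/-!
# Density over the commutant, XIX: HODGE DOMINATION OVER ALL ISOTYPIC CLASSES AT ONCE —
# `rank(Φ₀,Φ₁) = rank Φ₀ ⟺ ∀ c, D_c⟨b′_c⟩ ≤ D_c⟨b_c⟩`

COR-CM (cell `pub-hodgecm2`, binder seat `b16` gen 74, count-neutral claim SUB-FAMILY DOMINATION AND HODGE
EQUIVALENCE (closing gen 73's HONEST OPEN (i)), file S7 — abstract `G`-set level, type ranks, CM dress; theorems only,
no definition, no named fact, no `sorry`).  NEW as stated, hence under `Summits/`.  HONEST FRAMING: gen 73 K6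
(`…CommutantDominationFamilies`) decided Hodge domination of the pair `A₀ × A₁` by `A₀` CLASS BY CLASS —
`rank(Φ₀,Φ₁) = rank Φ₀ ⟺ ∀ c, S(p¹_c) ≤ S(p⁰_c)` for the class components `p⁰_c` of the shadow `w₀` and `p¹_c` of the
type vector `u₁` — and left the translation of each class condition into the D-linear test of gen 72 C6 to be done «by
invoking C6 class by class».  This file carries, for EVERY class label `c`, a reference stable irreducible
`A_c ≤ ℚ^{Y_c}` with commutant `𝒟_c` (ANY) and equivariant, jointly independent embeddings `ι⁰_{c,j} : A_c → ℚ^{Y₀}`,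
`ι¹_{c,k} : A_c → ℚ^{E₁}` assembling `p⁰_c = Σ_j ι⁰_{c,j}(b_{c,j})`, `p¹_c = Σ_k ι¹_{c,k}(b′_{c,k})`, and states ONE theorem:
**`rank(Φ₀,Φ₁) = rank Φ₀ ⟺ ∀ c, D_c⟨b′_c⟩ ≤ D_c⟨b_c⟩`**.  Nothing about Hodge classes is asserted; `HC_CM` is neither
used nor asserted.

* `typeRank_sigmaType_eq_typeRank_iff_forall_iSup_le_of_classes` (type ranks) and its CM dress
  `cmFamilyRank_eq_cmTypeRank_iff_forall_iSup_le_of_classes` (trace pivot `T₀ ⊆ K_{i₀}`):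
  **`dim MT(A₀ × A₁) = dim MT(A₀) ⟺` in every isotypic class the components of `u₁` are `D_c`-combinations of the
  components of the shadow of `Φ₀`**.

## References

* [Gordon1999HodgeAVSurvey] B. B. Gordon, *A survey of the Hodge conjecture for abelian varieties*, §3 Theorem (proof),
  7.5–7.7, 9.4.3.
* [Deligne1982HodgeCycles] P. Deligne, *Hodge cycles on abelian varieties*, LNM 900 (1982), I.5 (p. 53).
* [Serre1977] J.-P. Serre, *Linear Representations of Finite Groups*, GTM 42, §2.6.
* [Lang2002] S. Lang, *Algebra*, 3rd ed., XVII §3.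
-/

set_option autoImplicit false

noncomputable section

open scoped BigOperators Classical

universe u u' u₀ u₁ uJ v v' vC w

namespace Summit.HodgeConjecture.CorCM.IrrOdd

open Literature.NumberTheory.ComplexMultiplication

variable {G : Type w} [Group G] {Y₀ : Type v'} [MulAction G Y₀] [Fintype Y₀]
  {I : Type u'} {E : I → Type v} [∀ i, MulAction G (E i)] [∀ i, Fintype (E i)] [Fintype I] [∀ i, Nonempty (E i)]

/-- **HODGE DOMINATION OVER ALL ISOTYPIC CLASSES AT ONCE (type ranks).**  Setting of gen 73 K6 (slot `0` with an
equivariant pivot `r₀ : E₀ → Y₀` refining the trace classes and shadow `w₀ = Σ_c p⁰_c`, slot `1` with its type vector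
`u₁ = Σ_c p¹_c`, labelled stable irreducible constituents with no equivariant embedding between different labels)
together with, for EVERY label `c`, a reference stable irreducible `A_c ≤ ℚ^{Y_c}` (`A_c ≠ 0`, commutant `𝒟_c` ANY)
and equivariant, jointly independent embeddings assembling `p⁰_c = Σ_j ι⁰_{c,j}(b_{c,j})`, `p¹_c = Σ_k ι¹_{c,k}(b′_{c,k})`.
Then **`rank(Φ₀,Φ₁) = rank Φ₀ ⟺ ∀ c, D_c⟨b′_c⟩ ≤ D_c⟨b_c⟩`** (K6 class by class, each class read by gen 72 C6).
[cite: Gordon1999HodgeAVSurvey, §3 Theorem (proof), 7.5–7.7 and 9.4.3] [cite: Deligne1982HodgeCycles, I.5 (p. 53)]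
[cite: Serre1977, §2.6] [cite: Lang2002, XVII §3] -/
theorem typeRank_sigmaType_eq_typeRank_iff_forall_iSup_le_of_classes {ρ : G} {Φ : ∀ i, Set (E i)}
    (h : ∀ i, IsCMTypeWith ρ (Φ i)) {i₀ i₁ : I} (hI : ∀ j, j = i₀ ∨ j = i₁)
    (r₀ : E i₀ → Y₀) (hr₀ : ∀ (g : G) (x : E i₀), r₀ (g • x) = g • r₀ x)
    (hfine₀ : ∀ x x' : E i₀, r₀ x = r₀ x' → ∃ n : G, (∀ y : E i₁, n • y = y) ∧ n • x = x')
    {C : Type u} [Fintype C] {J₀ : Type u₀} {J₁ : Type u₁} [Fintype J₀] [Fintype J₁] (c₀ : J₀ → C) (c₁ : J₁ → C)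
    {A₀ : J₀ → Submodule ℚ (Y₀ → ℚ)} {A₁ : J₁ → Submodule ℚ (E i₁ → ℚ)}
    (hA₀st : ∀ (j : J₀) (k : G) (a : Y₀ → ℚ), a ∈ A₀ j → (fun y => a (k • y)) ∈ A₀ j)
    (hA₀irr : ∀ (j : J₀) (W : Submodule ℚ (Y₀ → ℚ)), W ≤ A₀ j → W ≠ ⊥ →
      (∀ (k : G) (f : Y₀ → ℚ), f ∈ W → (fun y => f (k • y)) ∈ W) → W = A₀ j)
    (hA₁st : ∀ (j : J₁) (k : G) (a : E i₁ → ℚ), a ∈ A₁ j → (fun y => a (k • y)) ∈ A₁ j)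
    (hA₁irr : ∀ (j : J₁) (W : Submodule ℚ (E i₁ → ℚ)), W ≤ A₁ j → W ≠ ⊥ →
      (∀ (k : G) (f : E i₁ → ℚ), f ∈ W → (fun y => f (k • y)) ∈ W) → W = A₁ j)
    (h₀₀ : ∀ (j k : J₀) (L : (Y₀ → ℚ) →ₗ[ℚ] (Y₀ → ℚ)), c₀ j ≠ c₀ k → A₀ j ≠ ⊥ → (∀ a ∈ A₀ j, L a ∈ A₀ k) →
      (∀ a ∈ A₀ j, L a = 0 → a = 0) → (∀ (g : G) (a : Y₀ → ℚ), a ∈ A₀ j →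
        L (fun y => a (g • y)) = fun y => L a (g • y)) → False)
    (h₀₁ : ∀ (j : J₀) (k : J₁) (L : (Y₀ → ℚ) →ₗ[ℚ] (E i₁ → ℚ)), c₀ j ≠ c₁ k → A₀ j ≠ ⊥ →
      (∀ a ∈ A₀ j, L a ∈ A₁ k) → (∀ a ∈ A₀ j, L a = 0 → a = 0) → (∀ (g : G) (a : Y₀ → ℚ), a ∈ A₀ j →
        L (fun y => a (g • y)) = fun y => L a (g • y)) → False)
    (h₁₀ : ∀ (j : J₁) (k : J₀) (L : (E i₁ → ℚ) →ₗ[ℚ] (Y₀ → ℚ)), c₁ j ≠ c₀ k → A₁ j ≠ ⊥ →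
      (∀ a ∈ A₁ j, L a ∈ A₀ k) → (∀ a ∈ A₁ j, L a = 0 → a = 0) → (∀ (g : G) (a : E i₁ → ℚ), a ∈ A₁ j →
        L (fun y => a (g • y)) = fun y => L a (g • y)) → False)
    (h₁₁ : ∀ (j k : J₁) (L : (E i₁ → ℚ) →ₗ[ℚ] (E i₁ → ℚ)), c₁ j ≠ c₁ k → A₁ j ≠ ⊥ → (∀ a ∈ A₁ j, L a ∈ A₁ k) →
      (∀ a ∈ A₁ j, L a = 0 → a = 0) → (∀ (g : G) (a : E i₁ → ℚ), a ∈ A₁ j →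
        L (fun y => a (g • y)) = fun y => L a (g • y)) → False)
    {p₀ : C → (Y₀ → ℚ)} {p₁ : C → (E i₁ → ℚ)}
    (hp₀ : ∀ c, p₀ c ∈ ⨆ j : {j // c₀ j = c}, A₀ j.1) (hp₁ : ∀ c, p₁ c ∈ ⨆ j : {j // c₁ j = c}, A₁ j.1)
    (hw₀ : (fun y : Y₀ => ∑ x ∈ Finset.univ.filter (fun x => r₀ x = y), antiVec (Φ i₀) (1 : G) x) = ∑ c, p₀ c)
    (hu₁ : antiVec (Φ i₁) (1 : G) = ∑ c, p₁ c)
    -- per class: a reference irreducible with commutant, and the assembling embeddings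
    {Yc : C → Type vC} [∀ c, MulAction G (Yc c)] [∀ c, Fintype (Yc c)]
    {Ar : ∀ c, Submodule ℚ (Yc c → ℚ)} {𝒟 : ∀ c, Submodule ℚ ((Yc c → ℚ) →ₗ[ℚ] (Yc c → ℚ))}
    (h𝒟 : ∀ c (L : (Yc c → ℚ) →ₗ[ℚ] (Yc c → ℚ)), L ∈ 𝒟 c ↔ (∀ a ∈ Ar c, L a ∈ Ar c) ∧
      ∀ (k : G) (a : Yc c → ℚ), a ∈ Ar c → L (fun y => a (k • y)) = fun y => L a (k • y))
    (hRst : ∀ c (k : G) (a : Yc c → ℚ), a ∈ Ar c → (fun y => a (k • y)) ∈ Ar c)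
    (hRirr : ∀ c (W : Submodule ℚ (Yc c → ℚ)), W ≤ Ar c → W ≠ ⊥ →
      (∀ (k : G) (f : Yc c → ℚ), f ∈ W → (fun y => f (k • y)) ∈ W) → W = Ar c)
    (hR0 : ∀ c, Ar c ≠ ⊥)
    {JJ₀ JJ₁ : C → Type uJ} [∀ c, Fintype (JJ₀ c)] [∀ c, Fintype (JJ₁ c)]
    (ι₀ : ∀ c, JJ₀ c → ((Yc c → ℚ) →ₗ[ℚ] (Y₀ → ℚ))) (ι₁ : ∀ c, JJ₁ c → ((Yc c → ℚ) →ₗ[ℚ] (E i₁ → ℚ)))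
    (hι₀eq : ∀ c (j : JJ₀ c) (k : G) (a : Yc c → ℚ), a ∈ Ar c →
      ι₀ c j (fun y => a (k • y)) = fun y => ι₀ c j a (k • y))
    (hι₁eq : ∀ c (j : JJ₁ c) (k : G) (a : Yc c → ℚ), a ∈ Ar c →
      ι₁ c j (fun y => a (k • y)) = fun y => ι₁ c j a (k • y))
    (hind₀ : ∀ c (f : JJ₀ c → (Yc c → ℚ)), (∀ j, f j ∈ Ar c) → ∑ j, ι₀ c j (f j) = 0 → ∀ j, f j = 0)
    (hind₁ : ∀ c (f : JJ₁ c → (Yc c → ℚ)), (∀ j, f j ∈ Ar c) → ∑ j, ι₁ c j (f j) = 0 → ∀ j, f j = 0)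
    {b₀ : ∀ c, JJ₀ c → (Yc c → ℚ)} {b₁ : ∀ c, JJ₁ c → (Yc c → ℚ)}
    (hb₀ : ∀ c j, b₀ c j ∈ Ar c) (hb₁ : ∀ c j, b₁ c j ∈ Ar c)
    (hpb₀ : ∀ c, p₀ c = ∑ j, ι₀ c j (b₀ c j)) (hpb₁ : ∀ c, p₁ c = ∑ j, ι₁ c j (b₁ c j)) :
    typeRank G (sigmaType Φ) = typeRank G (Φ i₀) ↔
      ∀ c, (⨆ j, (𝒟 c).map (LinearMap.applyₗ (b₁ c j))) ≤ ⨆ j, (𝒟 c).map (LinearMap.applyₗ (b₀ c j)) := by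
  rw [typeRank_sigmaType_eq_typeRank_iff_forall_of_classes h hI r₀ hr₀ hfine₀ c₀ c₁ hA₀st hA₀irr hA₁st hA₁irr
    h₀₀ h₀₁ h₁₀ h₁₁ hp₀ hp₁ hw₀ hu₁]
  refine forall_congr' fun c => ?_
  rw [hpb₀ c, hpb₁ c]
  exact span_shadowCoeff_le_iff_iSup_le (h𝒟 c) (hRst c) (hRirr c) (hR0 c) (ι₀ c) (ι₁ c) (hι₀eq c) (hι₁eq c)
    (hind₀ c) (hind₁ c) (hb₀ c) (hb₁ c)

end Summit.HodgeConjecture.CorCM.IrrOdd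

/-! ### CM dress -/

namespace Summit.HodgeConjecture.CorCM

open CategoryTheory CategoryTheory.Limits NumberField Module IntermediateField
open Literature.NumberTheory.ComplexMultiplication
open Literature.AlgebraicGeometry.Motives (AbelianVariety CMType)
open Literature.AlgebraicGeometry.Motives.AbelianVariety
open Literature.AlgebraicGeometry.HodgeTheory
open Literature.AlgebraicGeometry.ComplexMultiplication (IsCMTypeRealisation)
open Literature.AlgebraicGeometry.Pohlmann1968

variable {I : Type} [Fintype I] {K : I → Type} [∀ i, Field (K i)] [∀ i, NumberField (K i)] [∀ i, IsCMField (K i)]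
  {T₀ : Type} [Field T₀] [NumberField T₀]

/-- **HODGE DOMINATION OVER ALL ISOTYPIC CLASSES AT ONCE (CM fields).**  `T₀ ⊆ K_{i₀}` a subfield containing the
traces (TR); labelled constituents and class components as in gen 73 K6's `cmFamilyRank_eq_cmTypeRank_iff_forall_of_classes`;
for every label `c` a reference `Aut(ℂ)`-stable irreducible `A_c ≤ ℚ^{Y_c}` (`A_c ≠ 0`, commutant ANY) with equivariant,
jointly independent embeddings assembling `p⁰_c`, `p¹_c` from components `b_{c,j}`, `b′_{c,k}`.  Then
**`dim MT(A₀ × A₁) = dim MT(A₀) ⟺ ∀ c, D_c⟨b′_c⟩ ≤ D_c⟨b_c⟩`**. [cite: Gordon1999HodgeAVSurvey, §3 Theorem (proof),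
7.5–7.7 and 9.4.3] [cite: Deligne1982HodgeCycles, I.5 (p. 53)] [cite: Lang2002, XVII §3] -/
theorem cmFamilyRank_eq_cmTypeRank_iff_forall_iSup_le_of_classes {i₀ i₁ : I} (hI : ∀ l, l = i₀ ∨ l = i₁)
    (Φ : ∀ i, CMType (K i)) [Algebra T₀ (K i₀)]
    (htr₀ : ∀ (a : K i₀ →+* ℂ) (k : K i₀), a k ∈ normalClosure ℚ (K i₁) ℂ → k ∈ Set.range (algebraMap T₀ (K i₀)))
    {C : Type} [Fintype C] {J₀ J₁ : Type} [Fintype J₀] [Fintype J₁] (c₀ : J₀ → C) (c₁ : J₁ → C)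
    {A₀ : J₀ → Submodule ℚ ((T₀ →+* ℂ) → ℚ)} {A₁ : J₁ → Submodule ℚ ((K i₁ →+* ℂ) → ℚ)}
    (hA₀st : ∀ (j : J₀) (k : ℂ ≃+* ℂ) (a : (T₀ →+* ℂ) → ℚ), a ∈ A₀ j → (fun y => a (k • y)) ∈ A₀ j)
    (hA₀irr : ∀ (j : J₀) (W : Submodule ℚ ((T₀ →+* ℂ) → ℚ)), W ≤ A₀ j → W ≠ ⊥ →
      (∀ (k : ℂ ≃+* ℂ) (f : (T₀ →+* ℂ) → ℚ), f ∈ W → (fun y => f (k • y)) ∈ W) → W = A₀ j)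
    (hA₁st : ∀ (j : J₁) (k : ℂ ≃+* ℂ) (a : (K i₁ →+* ℂ) → ℚ), a ∈ A₁ j → (fun y => a (k • y)) ∈ A₁ j)
    (hA₁irr : ∀ (j : J₁) (W : Submodule ℚ ((K i₁ →+* ℂ) → ℚ)), W ≤ A₁ j → W ≠ ⊥ →
      (∀ (k : ℂ ≃+* ℂ) (f : (K i₁ →+* ℂ) → ℚ), f ∈ W → (fun y => f (k • y)) ∈ W) → W = A₁ j)
    (h₀₀ : ∀ (j k : J₀) (L : ((T₀ →+* ℂ) → ℚ) →ₗ[ℚ] ((T₀ →+* ℂ) → ℚ)), c₀ j ≠ c₀ k → A₀ j ≠ ⊥ →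
      (∀ a ∈ A₀ j, L a ∈ A₀ k) → (∀ a ∈ A₀ j, L a = 0 → a = 0) → (∀ (g : ℂ ≃+* ℂ) (a : (T₀ →+* ℂ) → ℚ), a ∈ A₀ j →
        L (fun y => a (g • y)) = fun y => L a (g • y)) → False)
    (h₀₁ : ∀ (j : J₀) (k : J₁) (L : ((T₀ →+* ℂ) → ℚ) →ₗ[ℚ] ((K i₁ →+* ℂ) → ℚ)), c₀ j ≠ c₁ k → A₀ j ≠ ⊥ →
      (∀ a ∈ A₀ j, L a ∈ A₁ k) → (∀ a ∈ A₀ j, L a = 0 → a = 0) → (∀ (g : ℂ ≃+* ℂ) (a : (T₀ →+* ℂ) → ℚ), a ∈ A₀ j →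
        L (fun y => a (g • y)) = fun y => L a (g • y)) → False)
    (h₁₀ : ∀ (j : J₁) (k : J₀) (L : ((K i₁ →+* ℂ) → ℚ) →ₗ[ℚ] ((T₀ →+* ℂ) → ℚ)), c₁ j ≠ c₀ k → A₁ j ≠ ⊥ →
      (∀ a ∈ A₁ j, L a ∈ A₀ k) → (∀ a ∈ A₁ j, L a = 0 → a = 0) → (∀ (g : ℂ ≃+* ℂ) (a : (K i₁ →+* ℂ) → ℚ), a ∈ A₁ j →
        L (fun y => a (g • y)) = fun y => L a (g • y)) → False)
    (h₁₁ : ∀ (j k : J₁) (L : ((K i₁ →+* ℂ) → ℚ) →ₗ[ℚ] ((K i₁ →+* ℂ) → ℚ)), c₁ j ≠ c₁ k → A₁ j ≠ ⊥ →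
      (∀ a ∈ A₁ j, L a ∈ A₁ k) → (∀ a ∈ A₁ j, L a = 0 → a = 0) → (∀ (g : ℂ ≃+* ℂ) (a : (K i₁ →+* ℂ) → ℚ), a ∈ A₁ j →
        L (fun y => a (g • y)) = fun y => L a (g • y)) → False)
    {p₀ : C → ((T₀ →+* ℂ) → ℚ)} {p₁ : C → ((K i₁ →+* ℂ) → ℚ)}
    (hp₀ : ∀ c, p₀ c ∈ ⨆ j : {j // c₀ j = c}, A₀ j.1) (hp₁ : ∀ c, p₁ c ∈ ⨆ j : {j // c₁ j = c}, A₁ j.1)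
    (hw₀ : (fun y : T₀ →+* ℂ => ∑ t ∈ Finset.univ.filter (fun t : K i₀ →+* ℂ => t.comp (algebraMap T₀ (K i₀)) = y),
        antiVec (Φ i₀).1 (1 : ℂ ≃+* ℂ) t) = ∑ c, p₀ c)
    (hu₁ : antiVec (Φ i₁).1 (1 : ℂ ≃+* ℂ) = ∑ c, p₁ c)
    {Yc : C → Type} [∀ c, MulAction (ℂ ≃+* ℂ) (Yc c)] [∀ c, Fintype (Yc c)]
    {Ar : ∀ c, Submodule ℚ (Yc c → ℚ)} {𝒟 : ∀ c, Submodule ℚ ((Yc c → ℚ) →ₗ[ℚ] (Yc c → ℚ))}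
    (h𝒟 : ∀ c (L : (Yc c → ℚ) →ₗ[ℚ] (Yc c → ℚ)), L ∈ 𝒟 c ↔ (∀ a ∈ Ar c, L a ∈ Ar c) ∧
      ∀ (k : ℂ ≃+* ℂ) (a : Yc c → ℚ), a ∈ Ar c → L (fun y => a (k • y)) = fun y => L a (k • y))
    (hRst : ∀ c (k : ℂ ≃+* ℂ) (a : Yc c → ℚ), a ∈ Ar c → (fun y => a (k • y)) ∈ Ar c)
    (hRirr : ∀ c (W : Submodule ℚ (Yc c → ℚ)), W ≤ Ar c → W ≠ ⊥ →
      (∀ (k : ℂ ≃+* ℂ) (f : Yc c → ℚ), f ∈ W → (fun y => f (k • y)) ∈ W) → W = Ar c)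
    (hR0 : ∀ c, Ar c ≠ ⊥)
    {JJ₀ JJ₁ : C → Type} [∀ c, Fintype (JJ₀ c)] [∀ c, Fintype (JJ₁ c)]
    (ι₀ : ∀ c, JJ₀ c → ((Yc c → ℚ) →ₗ[ℚ] ((T₀ →+* ℂ) → ℚ)))
    (ι₁ : ∀ c, JJ₁ c → ((Yc c → ℚ) →ₗ[ℚ] ((K i₁ →+* ℂ) → ℚ)))
    (hι₀eq : ∀ c (j : JJ₀ c) (k : ℂ ≃+* ℂ) (a : Yc c → ℚ), a ∈ Ar c →
      ι₀ c j (fun y => a (k • y)) = fun y => ι₀ c j a (k • y))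
    (hι₁eq : ∀ c (j : JJ₁ c) (k : ℂ ≃+* ℂ) (a : Yc c → ℚ), a ∈ Ar c →
      ι₁ c j (fun y => a (k • y)) = fun y => ι₁ c j a (k • y))
    (hind₀ : ∀ c (f : JJ₀ c → (Yc c → ℚ)), (∀ j, f j ∈ Ar c) → ∑ j, ι₀ c j (f j) = 0 → ∀ j, f j = 0)
    (hind₁ : ∀ c (f : JJ₁ c → (Yc c → ℚ)), (∀ j, f j ∈ Ar c) → ∑ j, ι₁ c j (f j) = 0 → ∀ j, f j = 0)
    {b₀ : ∀ c, JJ₀ c → (Yc c → ℚ)} {b₁ : ∀ c, JJ₁ c → (Yc c → ℚ)}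
    (hb₀ : ∀ c j, b₀ c j ∈ Ar c) (hb₁ : ∀ c j, b₁ c j ∈ Ar c)
    (hpb₀ : ∀ c, p₀ c = ∑ j, ι₀ c j (b₀ c j)) (hpb₁ : ∀ c, p₁ c = ∑ j, ι₁ c j (b₁ c j)) :
    CMAlgebra.cmFamilyRank Φ = cmTypeRank (Φ i₀) ↔
      ∀ c, (⨆ j, (𝒟 c).map (LinearMap.applyₗ (b₁ c j))) ≤ ⨆ j, (𝒟 c).map (LinearMap.applyₗ (b₀ c j)) := by
  rw [cmFamilyRank_eq_cmTypeRank_iff_forall_of_classes hI Φ htr₀ c₀ c₁ hA₀st hA₀irr hA₁st hA₁irr h₀₀ h₀₁ h₁₀ h₁₁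
    hp₀ hp₁ hw₀ hu₁]
  refine forall_congr' fun c => ?_
  rw [hpb₀ c, hpb₁ c]
  exact IrrOdd.span_shadowCoeff_le_iff_iSup_le (h𝒟 c) (hRst c) (hRirr c) (hR0 c) (ι₀ c) (ι₁ c) (hι₀eq c)
    (hι₁eq c) (hind₀ c) (hind₁ c) (hb₀ c) (hb₁ c)

end Summit.HodgeConjecture.CorCM

end
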